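/-
COR-CM (cells pub-hodgecm / pub-hodgecm2, stage 2 of the Hodge ladder) — TRANSPOSITION item (vi), X3-Char ∕ Δ2 bridge supply:
the ω-side carriers of the S2 END displays (`OmegaMuSplitting.sMu ∕ hsMu ∕ hscMu`, `OmegaMuSplitting.muLocalSplittings ∕ hfac_sMu`,
✔ p321268 · p323278 · p333687, own-htheta lineage) RE-CUT GENERIC IN THE CHARACTER AND IN THE DIAGONAL FRAME: the same terms at an
ARBITRARY unitary splitting character `χ` of `U(1)` (`χ.IsUnitary`, `IsSplittingChar F 1 χ`) instead of the one character
`χ_μ = chiMu F ι₁ Φ`, and over an ARBITRARY real non-degenerate diagonal frame `(e, dV)` of the rank-3 hermitian space instead of the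
display's `(finProdFinEquiv, V.diagEntries)` — so that the SAME names serve the display frame (§V) and the ported package's frame
`(e₁, frameD V)` at the pinned dictionary.
WHY: the Δ2 bridge at the pinned dictionary (pin-3 `Item6PlacementJunctionAppendixCAtDictionary` v4, BRIDGE RECIPE X3-TREE-SOCKET v6–v8)
reads, at EVERY continuous index line `i` over a Gram class `q`, the line's splitting as `ι_{χ_i}` with `χ_i := χ_q · ratioHecke α_i`
(✔ p336650 `exists_eq_chiSplittingLine_of_isCompatible` + ✔ `centralCharFactorsThroughDet_rank_three`), and then needs the Liu-side
datum `R i hi : Thm418Rest C` — i.e. `Def411WeilCarriers.omega ∕ rho` at the `χ_i`-attached splitting FAMILY — together with the row-9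
inputs `𝓢`, `hfac` at `χ_i`; infinitely many characters `χ_i` occur, so the `χ_μ`-specialised plugs do not suffice.  Every decl below is
the own-htheta ∕ mc-theta-3 term with `(chiMu F ι₁ Φ, …)` replaced by `(χ, hχu, hχs)` and `(finProdFinEquiv, V.diagEntries, …)` by
`(e, dV, hdV, hdV0)`; §V specialises to the display frame and records that the displayed plugs ARE the specialisations (`rfl`).
Seat prover-pub-hodgecm2-item6-p3-g12-0 (item6-p3 gen 12, item-(vi) lineage; first refusal own-htheta g8 «GO» HOME/INBOX l.10014).
Two data defs (+ two reducible specialisations) + theorems; no named fact, no instance, no `variable` of Prop type; nothing landed is edited or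
restated.  HC_CM is NOT proved; this discharges no displayed hypothesis and moves no pointer.
-/
import Summits.HodgeConjecture.CorCM.B01.Transposition.Item6MuLocalSplittings
import HarnessLib

set_option autoImplicit false

/-!
# The ω-side carriers at an ARBITRARY unitary splitting character `χ` and diagonal frame `(e, dV)`

For a CM field `F`, a real non-degenerate diagonal frame `dV : Fin 3 → F` (`σ dVᵢ = dVᵢ ≠ 0`) with index equivalence
`e : Fin 3 × Fin 1 ≃ Fin n`, a unit `a` of `F⁺` (the hermitian line `⟨T_W a⟩` in the `Def411WeilCarriers` conventions) and a Hecke character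
`χ` of `F` with `χ.IsUnitary`, `IsSplittingChar F 1 χ`:

* §D `sChiD F e dV hdV hdV0 χ hχu hχs a` — the [GR91, Prop. 3.1.1] compatible continuous splitting of `U(diag dV)(𝔸) × U(J_W a)(𝔸)` ATTACHED TO
  `χ` (`Def411WeilCarriersDoubling.chiSplittingLine`: the undoubling of the `χ`-normalised doubled Weil representation), `hsChiD` (compatibility —
  the shape of the display binder `hs`), `hscChiD` ∕ `continuous_sChiD` (continuity), `sChiD_eq_splittingCongr_undoubleHom` (choice-free: the
  undoubling of ANY `χ`-normalised doubled Weil representation, (α-2)), `chiLocalSplittingsD` (the `χ`-normalised CM package of the doubled group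
  undoubled place by place, read on `(diag dV, J_W a)`) and `hfac_sChiD` (`sChiD` on the finite-adelic pair IS the reference section assembled
  from `chiLocalSplittingsD`: «undoubling commutes with place-assembly»);
* §V the display frame `(finProdFinEquiv, V.diagEntries)` of a face datum `V : HermSpace3 F ι₁`: `sChi ∕ hsChi ∕ hscChi ∕ continuous_sChi ∕
  chiLocalSplittings ∕ hfac_sChi`, and `sMu_eq_sChi`, `muLocalSplittings_eq_chiLocalSplittings` (`rfl`).

HC_CM is NOT proved.
-/

noncomputable section

open scoped Matrix Kronecker TensorProduct
open NumberField IsDedekindDomain MeasureTheory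
open Literature.RepresentationTheory.HeisenbergGroup
open Literature.NumberTheory.Weil1964

namespace Summit.HodgeConjecture.CorCM.Transposition.OmegaChiSplitting

open Literature.AlgebraicGeometry.Motives (CMType)
open Literature.NumberTheory.Automorphic
open Literature.NumberTheory.Automorphic.IdeleClassGroup
open Literature.NumberTheory.GaloisRepresentations
open Literature.RepresentationTheory.HarrisKudlaSweet1996
open Literature.RepresentationTheory.Liu2021
open Literature.NumberTheory.GelbartRogawski1991
open Literature.NumberTheory.GelbartRogawski1991.UnitaryDualPair
open Literature.NumberTheory.GelbartRogawski1991.UnitaryDualPair.WeilCoinv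
open Literature.NumberTheory.GelbartRogawski1991.UnitaryDualPair.LocalSplitting
open Literature.NumberTheory.GelbartRogawski1991.GRConstruction
open Literature.NumberTheory.Automorphic.Liu2021.Def411WeilCarriersDoubling
open Literature.NumberTheory.Automorphic.Liu2021.Def411WeilCarriers (TW JW JW_eq isSymm_TW isUnit_det_TW)
open Summit.HodgeConjecture.CorCM.Transposition.OmegaMuSplitting (chiMu chiMu_isUnitary chiMu_isSplittingChar sMu muLocalSplittings)

/-! ## §D The carriers over an arbitrary diagonal frame `(e, dV)` and character `χ` -/

section Frame

variable (F : CMField) {n : ℕ} (e : Fin 3 × Fin 1 ≃ Fin n) (dV : Fin 3 → F)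
  (hdV : ∀ i, IsCMField.complexConj F (dV i) = dV i) (hdV0 : ∀ i, dV i ≠ 0)
  (χ : HeckeCharacter F) (hχu : χ.IsUnitary) (hχs : IsSplittingChar F 1 χ)

/-- **the splitting ATTACHED TO `χ`** of `U(diag dV)(𝔸) × U(J_W a)(𝔸)` into the adelic metaplectic group of the pair: the undoubling of
the `χ`-normalised doubled Weil representation, transported to the line `⟨T_W a⟩` (`chiSplittingLine`).
[cite: GelbartRogawski1991, §3.1 Prop. 3.1.1 p. 455 L1–3] [cite: Liu2021, App. D §D.1 Step 2 (l. 5219)] -/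
def sChiD (a : (↥(maximalRealSubfield F))ˣ) :
    UnitaryGroup.adelicPair ↥(maximalRealSubfield F) F (IsCMField.complexConj F) 3 1 (Matrix.diagonal dV)
        (JW ↥(maximalRealSubfield F) F a) →*
      adelicMpCont ↥(maximalRealSubfield F) (Fin n)
        (adelicGram ↥(maximalRealSubfield F) e (realDiagonal F dV hdV) (TW ↥(maximalRealSubfield F) a)) :=
  chiSplittingLine F e dV hdV hdV0 χ hχu hχs (TW ↥(maximalRealSubfield F) a) (isUnit_det_TW ↥(maximalRealSubfield F) a)
    (JW ↥(maximalRealSubfield F) F a) (JW_eq ↥(maximalRealSubfield F) F a)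

/-- **`sChiD` is a compatible splitting of the line datum** — the shape of the `hs`-family consumed by `Def411WeilCarriers.omega ∕ rho`
(`isCompatible_chiSplittingLine`). [cite: GelbartRogawski1991, §3.1 Prop. 3.1.1 p. 455 L1–3] -/
theorem hsChiD (a : (↥(maximalRealSubfield F))ˣ) :
    (splittingDatum ↥(maximalRealSubfield F) F (IsCMField.complexConj F) 3 1 e (Matrix.diagonal dV)
        (JW ↥(maximalRealSubfield F) F a) (complexConj_imagUnit F) (imagUnit_ne_zero F) (imagUnit_mul_self F)
        (realDiagonal_isSymm F dV hdV) (isSymm_TW ↥(maximalRealSubfield F) a) (isUnit_det_realDiagonal F dV hdV hdV0)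
        (isUnit_det_TW ↥(maximalRealSubfield F) a) (realDiagonal_map F dV hdV).symm
        (JW_eq ↥(maximalRealSubfield F) F a)).IsCompatible
      (sChiD F e dV hdV hdV0 χ hχu hχs a) :=
  isCompatible_chiSplittingLine F e dV hdV hdV0 χ hχu hχs (TW ↥(maximalRealSubfield F) a)
    (isSymm_TW ↥(maximalRealSubfield F) a) (isUnit_det_TW ↥(maximalRealSubfield F) a) (JW ↥(maximalRealSubfield F) F a)
    (JW_eq ↥(maximalRealSubfield F) F a)

/-- **the pair splitting of `sChiD` is continuous** (`continuous_pairSplitting_chiSplittingLine`).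
[cite: GelbartRogawski1991, §3.1 Prop. 3.1.1 p. 455 L1–3] -/
theorem hscChiD (a : (↥(maximalRealSubfield F))ˣ) :
    Continuous (pairSplitting ↥(maximalRealSubfield F) F (IsCMField.complexConj F) 3 1 e (Matrix.diagonal dV)
      (JW ↥(maximalRealSubfield F) F a) (sChiD F e dV hdV hdV0 χ hχu hχs a)) :=
  continuous_pairSplitting_chiSplittingLine F e dV hdV hdV0 χ hχu hχs (TW ↥(maximalRealSubfield F) a)
    (isUnit_det_TW ↥(maximalRealSubfield F) a) (JW ↥(maximalRealSubfield F) F a) (JW_eq ↥(maximalRealSubfield F) F a)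

/-- `sChiD` itself is continuous (`continuous_chiSplittingLine`). [cite: GelbartRogawski1991, §3.1 Prop. 3.1.1 p. 455 L1–3] -/
theorem continuous_sChiD (a : (↥(maximalRealSubfield F))ˣ) : Continuous (sChiD F e dV hdV hdV0 χ hχu hχs a) :=
  continuous_chiSplittingLine F e dV hdV hdV0 χ hχu hχs (TW ↥(maximalRealSubfield F) a)
    (isUnit_det_TW ↥(maximalRealSubfield F) a) (JW ↥(maximalRealSubfield F) F a) (JW_eq ↥(maximalRealSubfield F) F a)

/-- **`sChiD` is choice-free**: it is the transport of `undoubleHom sD` for EVERY `χ`-normalised doubled Weil representation `sD` of the line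
datum — (α-2) `chiSplittingLine_eq_splittingCongr_undoubleHom` ([GR91] §3.1 p. 455 L1–3 ∕ [HKS96] §1 (1.14)–(1.15): uniqueness).
[cite: GelbartRogawski1991, §3.1 Prop. 3.1.1 p. 455 L1–3 and §3.2 Remark p. 457] [cite: HarrisKudlaSweet1996, §1 (1.14)–(1.15)] -/
theorem sChiD_eq_splittingCongr_undoubleHom (a : (↥(maximalRealSubfield F))ˣ)
    {sD : HA F e dV hdV (lineW F (TW ↥(maximalRealSubfield F) a)) (complexConj_lineW F (TW ↥(maximalRealSubfield F) a)) →*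
      MpD F e dV hdV (lineW F (TW ↥(maximalRealSubfield F) a)) (complexConj_lineW F (TW ↥(maximalRealSubfield F) a))}
    (h : IsDoubledWeilRep F e dV hdV hdV0 (lineW F (TW ↥(maximalRealSubfield F) a))
      (complexConj_lineW F (TW ↥(maximalRealSubfield F) a))
      (lineW_ne_zero F (TW ↥(maximalRealSubfield F) a) (isUnit_det_TW ↥(maximalRealSubfield F) a)) χ sD) :
    sChiD F e dV hdV hdV0 χ hχu hχs a =
      splittingCongr (Fp F) F (IsCMField.complexConj F) 3 1 e (Matrix.diagonal dV)
        (realDiagonal_lineW F (TW ↥(maximalRealSubfield F) a))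
        (diagonal_lineW F (TW ↥(maximalRealSubfield F) a) (JW_eq ↥(maximalRealSubfield F) F a))
        (undoubleHom F e dV hdV hdV0 (lineW F (TW ↥(maximalRealSubfield F) a)) (complexConj_lineW F (TW ↥(maximalRealSubfield F) a))
          (lineW_ne_zero F (TW ↥(maximalRealSubfield F) a) (isUnit_det_TW ↥(maximalRealSubfield F) a)) sD h.proj_eq) :=
  chiSplittingLine_eq_splittingCongr_undoubleHom F e dV hdV hdV0 χ hχu hχs (TW ↥(maximalRealSubfield F) a)
    (isUnit_det_TW ↥(maximalRealSubfield F) a) (JW ↥(maximalRealSubfield F) F a) (JW_eq ↥(maximalRealSubfield F) F a) h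

/-- **the `χ`-attached LOCAL SPLITTINGS at the line `⟨a⟩`**: the `χ`-normalised per-place package of the doubled group `U(diag dV ⊗ (a) ⊕ −)`
(`cmFinLocalFamily` at `χ`, Haar data of record `borelPlaceMeasure`), undoubled place by place (`undoubledSplittings`), read on the Gram data
`T_W = TW a`, `J_W = JW a` (`congrW`).  Liu's `ι_{μ_v}` at every finite place, as a tree term, for every `χ`.
[cite: GelbartRogawski1991, §3.1 Prop. 3.1.1 p. 455 L1–3] [cite: Liu2021, App. D §D.1 Step 2 (l. 5219)] -/
def chiLocalSplittingsD (a : (↥(maximalRealSubfield F))ˣ) :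
    FinLocalSplittings ↥(maximalRealSubfield F) F (IsCMField.complexConj F) n (complexConj_imagUnit F) (imagUnit_ne_zero F)
      (imagUnit_mul_self F)
      (gram ↥(maximalRealSubfield F) e (realDiagonal F dV hdV) (TW ↥(maximalRealSubfield F) a))
      (isSymm_gram ↥(maximalRealSubfield F) e (realDiagonal_isSymm F dV hdV) (isSymm_TW ↥(maximalRealSubfield F) a))
      (J := Matrix.reindex e e (Matrix.diagonal dV ⊗ₖ JW ↥(maximalRealSubfield F) F a))
      (reindex_kronecker_eq_gram_map ↥(maximalRealSubfield F) F e (realDiagonal_map F dV hdV).symm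
        (JW_eq ↥(maximalRealSubfield F) F a)) :=
  congrW F e dV hdV (lineW F (TW ↥(maximalRealSubfield F) a)) (complexConj_lineW F (TW ↥(maximalRealSubfield F) a))
    (realDiagonal_lineW F (TW ↥(maximalRealSubfield F) a))
    (diagonal_lineW F (TW ↥(maximalRealSubfield F) a) (JW_eq ↥(maximalRealSubfield F) F a))
    (undoubledSplittings F e dV hdV hdV0 (lineW F (TW ↥(maximalRealSubfield F) a)) (complexConj_lineW F (TW ↥(maximalRealSubfield F) a))
      (lineW_ne_zero F (TW ↥(maximalRealSubfield F) a) (isUnit_det_TW ↥(maximalRealSubfield F) a)) χ (borelPlaceMeasure F)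
      (cmFinLocalFamily F e dV hdV hdV0 (lineW F (TW ↥(maximalRealSubfield F) a)) (complexConj_lineW F (TW ↥(maximalRealSubfield F) a))
        (lineW_ne_zero F (TW ↥(maximalRealSubfield F) a) (isUnit_det_TW ↥(maximalRealSubfield F) a)) χ hχs (borelPlaceMeasure F)))
    (isSymm_TW ↥(maximalRealSubfield F) a) (JW_eq ↥(maximalRealSubfield F) F a)

set_option maxHeartbeats 4000000 in
-- (as own-htheta's `hfac_sMu`: the statement carries the `splittingDatum` telescope of the reference section)
/-- **`hfac` at `χ`**: the `χ`-attached splitting `sChiD … a`, read on the finite-adelic pair `U(diag dV)(𝔸_f) × U(J_W a)(𝔸_f)`, IS the reference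
section assembled from `chiLocalSplittingsD … a`: `sChiD = splittingCongr … (undoubleHom sD)` at the EXPLICIT `χ`-normalised doubled Weil
representation `assemble (finHalf (cmFinLocalFamily χ …)) sa` (any archimedean half `sa`, `exists_isArchHalf`), then «undoubling commutes with
place-assembly» (`pairSmall₁_splittingCongr_undoubleHom_assemble_eq_localRefSection`).  Own-htheta's `hfac_sMu`, generic in `χ` and the frame.
[cite: GelbartRogawski1991, §3.1 Prop. 3.1.1 p. 455 L1–3, Remark p. 457 L4–13] [cite: Liu2021, App. D §D.1 Step 2 (l. 5219)] -/
theorem hfac_sChiD (a : (↥(maximalRealSubfield F))ˣ) :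
    (pairSmall₁ ↥(maximalRealSubfield F) F (IsCMField.complexConj F) 3 1 e (Matrix.diagonal dV)
        (JW ↥(maximalRealSubfield F) F a) (sChiD F e dV hdV hdV0 χ hχu hχs a)).comp
      (finPairToAdelic ↥(maximalRealSubfield F) F (IsCMField.complexConj F) 3 1 (Matrix.diagonal dV)
        (JW ↥(maximalRealSubfield F) F a)) =
    localRefSection ↥(maximalRealSubfield F) F (IsCMField.complexConj F) 3 1 e (Matrix.diagonal dV)
      (JW ↥(maximalRealSubfield F) F a) (complexConj_imagUnit F) (imagUnit_ne_zero F) (imagUnit_mul_self F)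
      (realDiagonal_isSymm F dV hdV) (isSymm_TW ↥(maximalRealSubfield F) a) (realDiagonal_map F dV hdV).symm
      (JW_eq ↥(maximalRealSubfield F) F a) (chiLocalSplittingsD F e dV hdV hdV0 χ hχs a) := by
  obtain ⟨sa, ha⟩ := exists_isArchHalf F e dV hdV hdV0 (lineW F (TW ↥(maximalRealSubfield F) a))
    (complexConj_lineW F (TW ↥(maximalRealSubfield F) a))
    (lineW_ne_zero F (TW ↥(maximalRealSubfield F) a) (isUnit_det_TW ↥(maximalRealSubfield F) a)) χ hχu hχs
  have hs := sChiD_eq_splittingCongr_undoubleHom F e dV hdV hdV0 χ hχu hχs a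
    (isDoubledWeilRep_assemble F e dV hdV hdV0 (lineW F (TW ↥(maximalRealSubfield F) a))
      (complexConj_lineW F (TW ↥(maximalRealSubfield F) a))
      (lineW_ne_zero F (TW ↥(maximalRealSubfield F) a) (isUnit_det_TW ↥(maximalRealSubfield F) a)) χ
      (finHalf_isFinHalf F e dV hdV hdV0 (lineW F (TW ↥(maximalRealSubfield F) a))
        (complexConj_lineW F (TW ↥(maximalRealSubfield F) a))
        (lineW_ne_zero F (TW ↥(maximalRealSubfield F) a) (isUnit_det_TW ↥(maximalRealSubfield F) a)) χ (borelPlaceMeasure F)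
        (cmFinLocalFamily F e dV hdV hdV0 (lineW F (TW ↥(maximalRealSubfield F) a))
          (complexConj_lineW F (TW ↥(maximalRealSubfield F) a))
          (lineW_ne_zero F (TW ↥(maximalRealSubfield F) a) (isUnit_det_TW ↥(maximalRealSubfield F) a)) χ hχs
          (borelPlaceMeasure F)))
      ha)
  have key := pairSmall₁_splittingCongr_undoubleHom_assemble_eq_localRefSection F e dV hdV hdV0
    (lineW F (TW ↥(maximalRealSubfield F) a)) (complexConj_lineW F (TW ↥(maximalRealSubfield F) a))
    (lineW_ne_zero F (TW ↥(maximalRealSubfield F) a) (isUnit_det_TW ↥(maximalRealSubfield F) a)) χ (borelPlaceMeasure F)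
    (cmFinLocalFamily F e dV hdV hdV0 (lineW F (TW ↥(maximalRealSubfield F) a))
      (complexConj_lineW F (TW ↥(maximalRealSubfield F) a))
      (lineW_ne_zero F (TW ↥(maximalRealSubfield F) a) (isUnit_det_TW ↥(maximalRealSubfield F) a)) χ hχs (borelPlaceMeasure F))
    (realDiagonal_lineW F (TW ↥(maximalRealSubfield F) a))
    (diagonal_lineW F (TW ↥(maximalRealSubfield F) a) (JW_eq ↥(maximalRealSubfield F) F a))
    (isSymm_TW ↥(maximalRealSubfield F) a) (JW_eq ↥(maximalRealSubfield F) F a) ha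
  exact (congrArg (fun s => (pairSmall₁ ↥(maximalRealSubfield F) F (IsCMField.complexConj F) 3 1 e (Matrix.diagonal dV)
      (JW ↥(maximalRealSubfield F) F a) s).comp
    (finPairToAdelic ↥(maximalRealSubfield F) F (IsCMField.complexConj F) 3 1 (Matrix.diagonal dV)
      (JW ↥(maximalRealSubfield F) F a))) hs).trans key

end Frame

/-! ## §V The display frame `(finProdFinEquiv, V.diagEntries)` of a face datum, and the `χ_μ`-plugs as specialisations -/

section Display

variable (F : CMField) (ι₁ : F →+* ℂ) (V : HermSpace3 F ι₁) (χ : HeckeCharacter F) (hχu : χ.IsUnitary)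
  (hχs : IsSplittingChar F 1 χ)

/-- `sChiD` at the display frame `(finProdFinEquiv, V.diagEntries)` of the face datum `V` (the END display's Gram conventions).
[cite: GelbartRogawski1991, §3.1 Prop. 3.1.1 p. 455 L1–3] -/
abbrev sChi (a : (↥(maximalRealSubfield F))ˣ) :
    UnitaryGroup.adelicPair ↥(maximalRealSubfield F) F (IsCMField.complexConj F) 3 1 (Matrix.diagonal V.diagEntries)
        (JW ↥(maximalRealSubfield F) F a) →*
      adelicMpCont ↥(maximalRealSubfield F) (Fin (3 * 1))
        (adelicGram ↥(maximalRealSubfield F) finProdFinEquiv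
          (realDiagonal F V.diagEntries V.complexConj_diagEntries) (TW ↥(maximalRealSubfield F) a)) :=
  sChiD F finProdFinEquiv V.diagEntries V.complexConj_diagEntries V.diagEntries_ne_zero χ hχu hχs a

set_option maxHeartbeats 4000000 in
/-- **`sChi` is compatible** — VERBATIM the display binder type of `hs` (cf. `OmegaMuSplitting.hsMu`) at the character `χ`.
[cite: GelbartRogawski1991, §3.1 Prop. 3.1.1 p. 455 L1–3] -/
theorem hsChi (a : (↥(maximalRealSubfield F))ˣ) :
    (splittingDatum ↥(maximalRealSubfield F) F (IsCMField.complexConj F) 3 1 finProdFinEquiv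
        (Matrix.diagonal V.diagEntries) (JW ↥(maximalRealSubfield F) F a) (complexConj_imagUnit F) (imagUnit_ne_zero F)
        (imagUnit_mul_self F) (realDiagonal_isSymm F V.diagEntries V.complexConj_diagEntries)
        (isSymm_TW ↥(maximalRealSubfield F) a)
        (isUnit_det_realDiagonal F V.diagEntries V.complexConj_diagEntries V.diagEntries_ne_zero)
        (isUnit_det_TW ↥(maximalRealSubfield F) a)
        (realDiagonal_map F V.diagEntries V.complexConj_diagEntries).symm (JW_eq ↥(maximalRealSubfield F) F a)).IsCompatible
      (sChi F ι₁ V χ hχu hχs a) :=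
  hsChiD F finProdFinEquiv V.diagEntries V.complexConj_diagEntries V.diagEntries_ne_zero χ hχu hχs a

/-- the pair splitting of `sChi` is continuous — the display binder type of `hsc` at `χ`. [cite: GelbartRogawski1991, §3.1 Prop. 3.1.1 p. 455 L1–3] -/
theorem hscChi (a : (↥(maximalRealSubfield F))ˣ) :
    Continuous (pairSplitting ↥(maximalRealSubfield F) F (IsCMField.complexConj F) 3 1 finProdFinEquiv
      (Matrix.diagonal V.diagEntries) (JW ↥(maximalRealSubfield F) F a) (sChi F ι₁ V χ hχu hχs a)) :=
  hscChiD F finProdFinEquiv V.diagEntries V.complexConj_diagEntries V.diagEntries_ne_zero χ hχu hχs a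

/-- `sChi` is continuous. [cite: GelbartRogawski1991, §3.1 Prop. 3.1.1 p. 455 L1–3] -/
theorem continuous_sChi (a : (↥(maximalRealSubfield F))ˣ) : Continuous (sChi F ι₁ V χ hχu hχs a) :=
  continuous_sChiD F finProdFinEquiv V.diagEntries V.complexConj_diagEntries V.diagEntries_ne_zero χ hχu hχs a

/-- `chiLocalSplittingsD` at the display frame. [cite: GelbartRogawski1991, §3.1 Prop. 3.1.1 p. 455 L1–3] -/
abbrev chiLocalSplittings (a : (↥(maximalRealSubfield F))ˣ) :
    FinLocalSplittings ↥(maximalRealSubfield F) F (IsCMField.complexConj F) (3 * 1) (complexConj_imagUnit F) (imagUnit_ne_zero F)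
      (imagUnit_mul_self F)
      (gram ↥(maximalRealSubfield F) finProdFinEquiv (realDiagonal F V.diagEntries V.complexConj_diagEntries) (TW ↥(maximalRealSubfield F) a))
      (isSymm_gram ↥(maximalRealSubfield F) finProdFinEquiv (realDiagonal_isSymm F V.diagEntries V.complexConj_diagEntries)
        (isSymm_TW ↥(maximalRealSubfield F) a))
      (J := Matrix.reindex finProdFinEquiv finProdFinEquiv (Matrix.diagonal V.diagEntries ⊗ₖ JW ↥(maximalRealSubfield F) F a))
      (reindex_kronecker_eq_gram_map ↥(maximalRealSubfield F) F finProdFinEquiv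
        (realDiagonal_map F V.diagEntries V.complexConj_diagEntries).symm (JW_eq ↥(maximalRealSubfield F) F a)) :=
  chiLocalSplittingsD F finProdFinEquiv V.diagEntries V.complexConj_diagEntries V.diagEntries_ne_zero χ hχs a

set_option maxHeartbeats 4000000 in
/-- `hfac` at the display frame: `sChi … a` on the finite-adelic pair IS the reference section of `chiLocalSplittings … a`.
[cite: GelbartRogawski1991, §3.1 Prop. 3.1.1 p. 455 L1–3, Remark p. 457 L4–13] -/
theorem hfac_sChi (a : (↥(maximalRealSubfield F))ˣ) :
    (pairSmall₁ ↥(maximalRealSubfield F) F (IsCMField.complexConj F) 3 1 finProdFinEquiv (Matrix.diagonal V.diagEntries)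
        (JW ↥(maximalRealSubfield F) F a) (sChi F ι₁ V χ hχu hχs a)).comp
      (finPairToAdelic ↥(maximalRealSubfield F) F (IsCMField.complexConj F) 3 1 (Matrix.diagonal V.diagEntries)
        (JW ↥(maximalRealSubfield F) F a)) =
    localRefSection ↥(maximalRealSubfield F) F (IsCMField.complexConj F) 3 1 finProdFinEquiv (Matrix.diagonal V.diagEntries)
      (JW ↥(maximalRealSubfield F) F a) (complexConj_imagUnit F) (imagUnit_ne_zero F) (imagUnit_mul_self F)
      (realDiagonal_isSymm F V.diagEntries V.complexConj_diagEntries) (isSymm_TW ↥(maximalRealSubfield F) a)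
      (realDiagonal_map F V.diagEntries V.complexConj_diagEntries).symm (JW_eq ↥(maximalRealSubfield F) F a)
      (chiLocalSplittings F ι₁ V χ hχs a) :=
  hfac_sChiD F finProdFinEquiv V.diagEntries V.complexConj_diagEntries V.diagEntries_ne_zero χ hχu hχs a

/-- the display's splitting `OmegaMuSplitting.sMu F ι₁ V Φ` IS `sChi` at `χ_μ = chiMu F ι₁ Φ` (definitional). [folklore] -/
theorem sMu_eq_sChi (Φ : CMType F) (a : (↥(maximalRealSubfield F))ˣ) :
    sMu F ι₁ V Φ a = sChi F ι₁ V (chiMu F ι₁ Φ) (chiMu_isUnitary F ι₁ Φ) (chiMu_isSplittingChar F ι₁ Φ) a :=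
  rfl

/-- the display's local splittings `OmegaMuSplitting.muLocalSplittings F ι₁ V Φ` ARE `chiLocalSplittings` at `χ_μ` (definitional). [folklore] -/
theorem muLocalSplittings_eq_chiLocalSplittings (Φ : CMType F) (a : (↥(maximalRealSubfield F))ˣ) :
    muLocalSplittings F ι₁ V Φ a = chiLocalSplittings F ι₁ V (chiMu F ι₁ Φ) (chiMu_isSplittingChar F ι₁ Φ) a :=
  rfl

end Display

end Summit.HodgeConjecture.CorCM.Transposition.OmegaChiSplitting

end
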